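import Summits.CriticalPhenomena.PercolationContinuityZ3.Theorems.PercNearOneGluingNoHeavyLowerTailSahiOneStepCone
import HarnessLib

/-!
# The `(2′)` functional `n` of the one-step scheme is a POSITIVE SEMIDEFINITE bilinear form — the square (Gram) normal form

Support file (prover prim-ineq-prove-3 gen 29; `--supports stmt-CriticalPhenomena-4575`; memo
`run/shared/lean/prim/prim-ineq-prove-3/FINDING-G29-FLOW-NORMAL-FORMS.md` §0(i), §1.1).  No definitions, no named facts, no sorries,
no `native_decide`.

For an ARBITRARY first event `H` and ARBITRARY functions `f, g` (no monotonicity, no product structure beyond the weight being a probability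
weight) the antithetic-pattern functional `n = osN p H` of `…SahiOneStepDefs` (on up-set indicators `n(1_A,1_B) ≥ 0` is the `(2′)` half
`Cov(A,B) ≥ μ(Hᶜ)·Cov(A,B ∣ Hᶜ)` of the one-step scheme, the last open input for Kahn C5 / Sahi C₃ with a Hamming-threshold first slot at a
general density vector) has the exact normal form
* `osN_eq_sq_form`:  `n(f,g) = (1 − E1_H)·E[1_H (f − Ef)(g − Eg)] + (E[1_H f] − E1_H·Ef)·(E[1_H g] − E1_H·Eg)`,
  i.e. `n(f,g)/μ(L) = E[1_H f̃ g̃] + Cov(f,1_H)Cov(g,1_H)/μ(L)` with `f̃ = f − Ef`, `L = Hᶜ`;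
* `osN_self_nonneg`: hence `n(f,f) ≥ 0` for EVERY `f` — `n` is positive semidefinite, and `(2′)` is the statement that the cone of increasing
  functions is ACUTE for this inner product (memo §0(i));
* `osN_sq_le`: the Cauchy–Schwarz inequality `n(f,g)² ≤ n(f,f)·n(g,g)` (discriminant of `λ ↦ n(f+λg, f+λg) ≥ 0`, bilinearity from `…SahiOneStepCone`).
-/

noncomputable section

namespace Summit.CriticalPhenomena.PercolationContinuityZ3.Theorems

namespace SahiOneStep

open Literature.Combinatorics.Sahi2008
open Literature.Probability.Percolation.DecisionTree (ind ind_of_mem ind_of_not_mem ind_nonneg)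
open Literature.Probability.Percolation.BHK2006 (weight weight_nonneg)
open SahiCdd (ex_congr' ex_lin4)

variable {ι : Type*} [Fintype ι]

/-- **Square normal form of the `(2′)` functional.**  For every event `H` and all functions `f, g`:
`n(f,g) = (1 − E1_H)·E[1_H·(f − Ef)·(g − Eg)] + (E[1_H f] − E1_H·Ef)·(E[1_H g] − E1_H·Eg)`
(the second factor pair is `Cov(f,1_H)`, `Cov(g,1_H)`). [this work] -/
theorem osN_eq_sq_form (p : ι → unitInterval) (H : Set (Set ι)) (f g : Set ι → ℝ) :
    osN p H f g =
      (1 - ex (bernoulliWeight p) (ind H)) *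
          ex (bernoulliWeight p) (fun ω => ind H ω * (f ω - ex (bernoulliWeight p) f) * (g ω - ex (bernoulliWeight p) g))
        + (ex (bernoulliWeight p) (ind H * f) - ex (bernoulliWeight p) (ind H) * ex (bernoulliWeight p) f)
          * (ex (bernoulliWeight p) (ind H * g) - ex (bernoulliWeight p) (ind H) * ex (bernoulliWeight p) g) := by
  set μ := bernoulliWeight p with hμ
  set a := ex μ f with ha
  set b := ex μ g with hb
  have hexp : ex μ (fun ω => ind H ω * (f ω - a) * (g ω - b)) =
      1 * ex μ (ind H * f * g) + (-b) * ex μ (ind H * f) + (-a) * ex μ (ind H * g) + (a * b) * ex μ (ind H) := by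
    rw [← ex_lin4]
    exact ex_congr' fun ω => by simp only [Pi.mul_apply]; ring
  unfold osN osCert
  rw [hexp]
  ring

/-- **`n` is positive semidefinite**: `0 ≤ n(f,f)` for EVERY function `f` (not only increasing ones) and every event `H`.
[this work] -/
theorem osN_self_nonneg (p : ι → unitInterval) (H : Set (Set ι)) (f : Set ι → ℝ) : 0 ≤ osN p H f f := by
  have hμ0 : ∀ ω, 0 ≤ bernoulliWeight p ω := fun ω => weight_nonneg (fun i => (p i).2.1) (fun i => (p i).2.2) ω
  have hle : ex (bernoulliWeight p) (ind H) ≤ 1 := by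
    rw [ex_bernoulliWeight_ind]; exact MeasureTheory.measureReal_le_one
  rw [osN_eq_sq_form]
  refine add_nonneg (mul_nonneg (sub_nonneg.2 hle) (ex_nonneg hμ0 fun ω => ?_)) (mul_self_nonneg _)
  have h1 : ind H ω * (f ω - ex (bernoulliWeight p) f) * (f ω - ex (bernoulliWeight p) f) =
      ind H ω * (f ω - ex (bernoulliWeight p) f) ^ 2 := by ring
  rw [h1]
  exact mul_nonneg (ind_nonneg _ _) (sq_nonneg _)

/-- **Cauchy–Schwarz for the `(2′)` functional**: `n(f,g)² ≤ n(f,f)·n(g,g)` for every event `H` and all functions `f, g`. [this work] -/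
theorem osN_sq_le (p : ι → unitInterval) (H : Set (Set ι)) (f g : Set ι → ℝ) :
    osN p H f g ^ 2 ≤ osN p H f f * osN p H g g := by
  classical
  -- the quadratic `x ↦ n(f + x g, f + x g) = n(g,g) x² + 2 n(f,g) x + n(f,f)` is nonnegative
  have hquad : ∀ x : ℝ, 0 ≤ osN p H g g * (x * x) + (2 * osN p H f g) * x + osN p H f f := by
    intro x
    have h := osN_self_nonneg p H (f + x • g)
    have e : osN p H (f + x • g) (f + x • g) = osN p H g g * (x * x) + (2 * osN p H f g) * x + osN p H f f := by
      rw [osN_add_smul_left, osN_comm p H f (f + x • g), osN_comm p H g (f + x • g), osN_add_smul_left, osN_add_smul_left,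
        osN_comm p H g f]
      ring
    rw [e] at h; exact h
  have hd := discrim_le_zero hquad
  unfold discrim at hd
  nlinarith [hd]

end SahiOneStep

end Summit.CriticalPhenomena.PercolationContinuityZ3.Theorems
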